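import Literature.MathematicalPhysics.QuantumFieldTheory.Balaban1983to89.B9Thm31SiteGsqSecondDecayReg335Y

/-!
# `Balaban1983to89.B9Thm31SiteGsqTransposedFactorsReg335Y` — T. Bałaban, *Propagators for lattice gauge theories in a background field*, Commun. Math. Phys. **99** (1985)
# 389–434 [Balaban1985BackgroundPropagators] (3.88)–(3.90) pp. 409–410 («G′ = G′₀(I − R′)⁻¹ … convergent in all norms appearing in (3.42)–(3.47)»), (3.8) p. 392, (3.46) p. 398,
# Cor 3.6 p. 408: **THE TRANSPOSED WALK FACTOR `M_hG′_□(U)K(h)(U)` BLOCK TO BLOCK, AND THE PER-PAIR SIXTH MEMBER `∇_μ∇_νM_hG′_□M_h`** — the two inputs of the LEFT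
# Neumann series `G′∇*_ν∇*_μ = Σ_n (R′ᵀ)ⁿ (G′₀∇*_ν∇*_μ)`, `∇_μ∇_νG′ = (∇_μ∇_νG′₀) Σ_n R′ⁿ` that avoid third-order bounds (file 33 of width seat `pub-ymgap-dag-n06-w1`'s set)

statement-level skeleton of published theorems with citation tags; proofs where landed; nothing here is a claim about the Yang–Mills mass gap

WHY (cell context, design note (r3), pub-ymgap bus 2026-08-28).  Print expands `G′ = G′₀(1 − R′)⁻¹`, `G′₀ = Σ_□ h_□G′_□h_□`, `R′ = Σ_□ K(h_□)G′_□h_□` ((3.88):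
`Δ′G′₀ = 1 − R′`).  Reading `G′∇*_ν∇*_μ` through this RIGHT series puts `∇*∇*` against the last factor `K(h)G′_□h`, a third-order object (dag-n06-k's
`FactorsL2Second37.facDD`, not in the tree, not printed in (3.46)).  Since `Δ′`, `G′_□`, `M_h` are trace-symmetric and `K(h)ᵀ = −K(h)`, the TRANSPOSED identity
`G′₀Δ′ = 1 − R′ᵀ`, `R′ᵀ = −Σ_□ h_□G′_□K(h_□)`, gives the LEFT series `G′ = Σ_n (R′ᵀ)ⁿG′₀`, hence `G′∇*_ν∇*_μ = Σ_n (R′ᵀ)ⁿ(G′₀∇*_ν∇*_μ)` — the second-order member meets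
`G′₀` only (file 32's `hs_block_sandwich_cdsS_cdsS_le`) and every Neumann factor is the FIRST-order transposed factor `h_□G′_□K(h_□)` of THIS file; dually
`∇_μ∇_νG′ = (∇_μ∇_νG′₀)Σ_n R′ⁿ` with the per-pair sixth member of THIS file and the plain factor of file 25.

WHAT IS PROVED (sorry-free; 0 `def`).
* §1 `isSkewTr_KhY` (`⟨K(h)(U)Φ, Ψ⟩₁ = −⟨Φ, K(h)(U)Ψ⟩₁` at `par = parSymY`, `G`-valued `U`, `G ≤ U(N)`), `trIP_KhY_GsqY_cutMulY_adjoint`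
  (`⟨K(h)G′_□M_hΨ, λ⟩₁ = ⟨Ψ, −M_hG′_□K(h)λ⟩₁`);
* §2 ★ `hs_block_cutMulY_GsqY_KhY_le_of_plain` — ANY block bound of the plain factor `K(h)G′_□M_h` from `Δ(t)` to `Δ(s)` IS a block bound of the transposed factor
  `M_hG′_□K(h)` from `Δ(s)` to `Δ(t)` (g2's `hs_restrict_dual_le`); ★★ `hs_block_cutMulY_GsqY_KhY_le_distT` — instantiated on file 25's plain-factor bound (any real
  cut-off `|h| ≤ 1`, `|∂h| ≤ κ`, `|∂∂h| ≤ κ₂`, block oscillation `≤ κ_b`, print's rate `e^{−2δ₀((n−2)∕(2L)−1)}`, `n ≤ d(s,t)`);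
* §3 ★ `hessian_block_pair_le` — the per-pair sixth member `Σ_{z∈Δ(s)}HS((∇_μ∇_νM_hG′_□M_hΦ)(z)) ≤ C₃∕E²·‖Φ‖²` (one term of file 32's `hessian_block_le`).
HONEST SCOPE: bookkeeping over landed estimates (files 25, 32); the resummation itself is dag-n06-k's ∕ dag-n06-d's schema, not done here; NOT a node discharge, NOT
summit progress; count-neutral; nothing continuum ∕ OS ∕ mass gap ∕ Clay; the YM mass gap (Clay) is NOT proved by any of this — R4 closes the conditional
finite-𝕋⁴ rung `BalabanLadder.UV` only.  NEW file importing file 32.  Net new unproved facts: 0.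
-/

noncomputable section

namespace Literature.MathematicalPhysics.QuantumFieldTheory.Balaban1983to89.B9Thm31SiteGsqTransposedFactorsReg335Y

open Literature.MathematicalPhysics.QuantumFieldTheory.Balaban1983to89
open Node00 B6KLevelCensusIndexV1 B6MultiLevelTorusOperator B6GlobalChartV1 B9BackgroundsKLevelV1
  B9Eq39Adjoint B9Thm311ReadingCoords B9Thm311DeltaPrimePos B9Ineq369CurvatureSmallAtLettersY B9Thm31SiteGpBoundsReg335Y
  B9Thm31SiteGsqHessianReg335Y B9Thm31SiteGsqSecondDecayReg335Y B9Thm31SiteGsqRecordCutoffReg335Y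
open Literature.MathematicalPhysics.QuantumFieldTheory.Balaban1983to89.B9Ineq349SiteAdjoint (trIP_comm trIP_cdS_left)
open Literature.MathematicalPhysics.QuantumFieldTheory.Balaban1983to89.B9Eq3132CoerciveVariational (trIP_sub_right trIP_sub_left)
open Literature.MathematicalPhysics.QuantumFieldTheory.Balaban1983to89.B9Thm37CubeCoverCommutators (cutMulY cutMulY_apply KhY KhY_def cutCommY_apply)
open Literature.MathematicalPhysics.QuantumFieldTheory.Balaban1983to89.B9Thm311DeltaPrimeSymm (deltaPrimeAY_isSymmTr_of_inv_symm)
open Literature.MathematicalPhysics.QuantumFieldTheory.Balaban1983to89.B9Thm311LocalInversePosY (trIP_cutMulY_right)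
open Literature.MathematicalPhysics.QuantumFieldTheory.Balaban1983to89.B9Thm31SiteGpDivDecayReg335Y (hs_restrict_dual_le)
open B6Geom246MultiLevelBox B6Geom246MultiLevelTorus B9Thm31SiteGsqBoundsReg335Y Node00.OpsYLocalInverse
open scoped Matrix Matrix.Norms.L2Operator

variable {d ℓ : ℕ} {hd : 1 ≤ d + 1} {hL : Odd (ℓ + 1) ∧ 1 < ℓ + 1} {b₀ b₁ : ℝ}
variable (i : KIdx d ℓ hd hL b₀ b₁) {N : ℕ} {G : Subgroup (Matrix (Fin N) (Fin N) ℂ)ˣ}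

/-! ## §1 `K(h)` is skew for the trace pairing; the adjoint of the plain factor is minus the transposed factor -/

section Skew

/-- the pairing is odd in the right slot. [folklore] -/
private theorem trIP_neg_right {S : Type} [Fintype S] (Φ X : S → Matrix (Fin N) (Fin N) ℂ) :
    trIP (fun _ => (1 : ℝ)) Φ (-X) = - trIP (fun _ => (1 : ℝ)) Φ X := by
  unfold trIP
  simp only [Pi.neg_apply, Matrix.neg_apply, mul_neg, Complex.neg_re, Finset.sum_neg_distrib]

/-- **`⟨K(h)(U)Φ, Ψ⟩₁ = −⟨Φ, K(h)(U)Ψ⟩₁`**: `K(h) = M_hΔ′_a − Δ′_aM_h` with `Δ′_a(U)` (dag-n06-j, route (S) at `parSymY`) and `M_h` trace-symmetric.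
[cite: Balaban1985BackgroundPropagators, (3.88) p.409, (3.24) p.394, Thm 3.11 p.416 («symmetric»)] -/
theorem isSkewTr_KhY (hG : G ≤ B7Prop2Explicit.unitaryUnits (Matrix (Fin N) (Fin N) ℂ)) {U : CfgY (Matrix (Fin N) (Fin N) ℂ) i}
    (hU : ∀ μ x, U μ x ∈ G) (h : SiteY i → ℝ) (Φ Ψ : SiteY i → Matrix (Fin N) (Fin N) ℂ) :
    trIP (fun _ => (1 : ℝ)) (KhY i (parSymY i) h U Φ) Ψ = - trIP (fun _ => (1 : ℝ)) Φ (KhY i (parSymY i) h U Ψ) := by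
  have hsymm := deltaPrimeAY_isSymmTr_of_inv_symm i hG (parSymY i) U (parSymY_inv_symm U) (parSymY_mem i hU) hU
  have eK : ∀ Λ : SiteY i → Matrix (Fin N) (Fin N) ℂ,
      KhY i (parSymY i) h U Λ = cutMulY h (deltaPrimeAY i (parSymY i) U Λ) - deltaPrimeAY i (parSymY i) U (cutMulY h Λ) := by
    intro Λ; funext z; rw [KhY_def, cutCommY_apply, Pi.sub_apply, cutMulY_apply]
  rw [eK Φ, eK Ψ, trIP_sub_left, trIP_sub_right, ← trIP_cutMulY_right, hsymm, hsymm (cutMulY h Φ), trIP_cutMulY_right]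
  ring

/-- `⟨K(h)G′_□(U)M_hΨ, λ⟩₁ = ⟨Ψ, −M_hG′_□(U)K(h)λ⟩₁` — the plain walk factor and minus the transposed one are adjoint.
[cite: Balaban1985BackgroundPropagators, (3.88) p.409, (3.8) p.392, Thm 3.11 p.416] -/
theorem trIP_KhY_GsqY_cutMulY_adjoint (hG : G ≤ B7Prop2Explicit.unitaryUnits (Matrix (Fin N) (Fin N) ℂ)) {U : CfgY (Matrix (Fin N) (Fin N) ℂ) i}
    (hU : ∀ μ x, U μ x ∈ G) (D : Finset (SiteY i)) (h : SiteY i → ℝ) (Ψ Λ : SiteY i → Matrix (Fin N) (Fin N) ℂ) :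
    trIP (fun _ => (1 : ℝ)) (KhY i (parSymY i) h U (GsqY i (parSymY i) D U (cutMulY h Ψ))) Λ
      = trIP (fun _ => (1 : ℝ)) Ψ (-(cutMulY h (GsqY i (parSymY i) D U (KhY i (parSymY i) h U Λ)))) := by
  rw [isSkewTr_KhY i hG hU, isSymmTr_GsqY_parSymY i hG hU D, ← trIP_cutMulY_right, trIP_neg_right]

end Skew

/-! ## §2 The transposed factor `M_hG′_□K(h)` block to block, by duality from the plain factor -/

section Transposed

/-- ★ **DUALITY FOR THE WALK FACTORS**: a block bound of the plain factor `K(h)G′_□(U)M_h` from `Δ(t)` to `Δ(s)` IS the same block bound of the transposed factor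
`M_hG′_□(U)K(h)(U)` from `Δ(s)` to `Δ(t)` (`‖1_tM_hG′_□K(h)1_s‖ = ‖1_sK(h)G′_□M_h1_t‖`). [cite: Balaban1985BackgroundPropagators, (3.88)–(3.90) pp.409–410, (3.8) p.392] -/
theorem hs_block_cutMulY_GsqY_KhY_le_of_plain (hG : G ≤ B7Prop2Explicit.unitaryUnits (Matrix (Fin N) (Fin N) ℂ)) {U : CfgY (Matrix (Fin N) (Fin N) ℂ) i}
    (hU : ∀ μ x, U μ x ∈ G) (D : Finset (SiteY i)) (h : SiteY i → ℝ) (s t : BlkY i) {C : ℝ} (hC : 0 ≤ C)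
    (hplain : ∀ Ψ : SiteY i → Matrix (Fin N) (Fin N) ℂ, (∀ z, blkOf i.D.toDomains z ≠ t → Ψ z = 0) →
      ∑ z ∈ Finset.univ.filter (fun z : SiteY i => blkOf i.D.toDomains z = s), ∑ a, ∑ b,
          ‖KhY i (parSymY i) h U (GsqY i (parSymY i) D U (cutMulY h Ψ)) z a b‖ ^ 2 ≤ C * trIP (fun _ => (1 : ℝ)) Ψ Ψ)
    {Λ : SiteY i → Matrix (Fin N) (Fin N) ℂ} (hΛ : ∀ z, blkOf i.D.toDomains z ≠ s → Λ z = 0) :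
    ∑ z ∈ Finset.univ.filter (fun z : SiteY i => blkOf i.D.toDomains z = t), ∑ a, ∑ b,
        ‖cutMulY h (GsqY i (parSymY i) D U (KhY i (parSymY i) h U Λ)) z a b‖ ^ 2 ≤ C * trIP (fun _ => (1 : ℝ)) Λ Λ := by
  classical
  have hdual := hs_restrict_dual_le (T := fun Ψ => KhY i (parSymY i) h U (GsqY i (parSymY i) D U (cutMulY h Ψ)))
    (T' := fun Λ' => -(cutMulY h (GsqY i (parSymY i) D U (KhY i (parSymY i) h U Λ'))))
    (fun Ψ Λ' => trIP_KhY_GsqY_cutMulY_adjoint i hG hU D h Ψ Λ')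
    (A := Finset.univ.filter (fun z : SiteY i => blkOf i.D.toDomains z = s)) (B := Finset.univ.filter (fun z : SiteY i => blkOf i.D.toDomains z = t))
    hC (fun Ψ hΨ => hplain Ψ fun z hz => hΨ z fun hz' => hz (Finset.mem_filter.1 hz').2) Λ
    (fun z hz => hΛ z fun e => hz (Finset.mem_filter.2 ⟨Finset.mem_univ _, e⟩))
  refine le_trans (le_of_eq ?_) hdual
  refine Finset.sum_congr rfl fun z _ => ?_
  simp only [Pi.neg_apply, Matrix.neg_apply, norm_neg]

variable [Nonempty (Fin N)] {c α₀ : ℝ}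

/-- ★★ **THE TRANSPOSED WALK FACTOR `M_hG′_□(U)K(h)(U)` FROM `Δ(s)` TO `Δ(t)` ON THE (3.35) CLASS**, any real cut-off (`|h| ≤ 1`, `|∂h| ≤ κ`, `|∂∂h| ≤ κ₂`, block
oscillation `≤ κ_b`), any `D`, with file 25's plain-factor constant (source level `lev s + 1`, output level `lev t`) and rate `e^{−2δ₀((n−2)∕(2L)−1)}`, `n ≤ d(s,t)`:
the first-order Neumann factor of the LEFT series `G′ = Σ_n (R′ᵀ)ⁿG′₀`. [cite: Balaban1985BackgroundPropagators, (3.88)–(3.90) pp.409–410, Cor 3.6 p.408, (3.46) p.398; Balaban1984PropagatorsII, (2.40)–(2.44) p.230, p.247; Agmon1982, Ch.1, Thm 1.5] -/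
theorem hs_block_cutMulY_GsqY_KhY_le_distT (hG : G ≤ B7Prop2Explicit.unitaryUnits (Matrix (Fin N) (Fin N) ℂ))
    {U : CfgY (Matrix (Fin N) (Fin N) ℂ) i} (hC0 : 0 ≤ c * (kGeo i).M * α₀) (hC1 : c * (kGeo i).M * α₀ * ((d : ℝ) + 1) ≤ 1 / 16)
    (hreg : (bg9K (Matrix (Fin N) (Fin N) ℂ) G i).Reg335 c α₀ U) (D : Finset (SiteY i))
    {h : SiteY i → ℝ} {κ κ₂ κb : ℝ} (hh1 : ∀ z, |h z| ≤ 1) (hhκ : ∀ μ z, |h (shiftY i μ z) - h z| ≤ κ)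
    (hhκ₂ : ∀ μ z, |h (shiftY i μ z) + h ((shiftY i μ).symm z) - 2 * h z| ≤ κ₂)
    (hhb : ∀ z w : SiteY i, blkOf i.D.toDomains w = blkOf i.D.toDomains z → |h z - h w| ≤ κb) (s t : BlkY i)
    {Λ : SiteY i → Matrix (Fin N) (Fin N) ℂ} (hΛ : ∀ z, blkOf i.D.toDomains z ≠ s → Λ z = 0) {n : ℕ} (hn : n ≤ (bondT i.D).dist s t) :
    ∑ z ∈ Finset.univ.filter (fun z : SiteY i => blkOf i.D.toDomains z = t), ∑ a, ∑ b,
        ‖cutMulY h (GsqY i (parSymY i) D U (KhY i (parSymY i) h U Λ)) z a b‖ ^ 2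
      ≤ (1280 * ((d : ℝ) + 1) * ((d : ℝ) + 2) * κ ^ 2 * ((((ℓ + 1) ^ (t.1.1 + 1) : ℕ) : ℝ)) ^ 2
          + (1024 * (((d : ℝ) + 1) * κ₂) ^ 2 + 512 * κb ^ 2 * ((((((ℓ + 1) ^ s.1.1 : ℕ) : ℝ)) ^ 2)⁻¹) ^ 2)
            * (((((ℓ + 1) ^ s.1.1 : ℕ) : ℝ)) ^ 2 * ((((ℓ + 1) ^ (t.1.1 + 1) : ℕ) : ℝ)) ^ 2))
        / Real.exp ((1 / (4 * ((d : ℝ) + 2))) * (((((n : ℝ)) - 2) / (2 * ((ℓ + 1 : ℕ) : ℝ)) - 1))) ^ 2 * trIP (fun _ => (1 : ℝ)) Λ Λ := by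
  have hU : ∀ μ x, U μ x ∈ G := hreg.1
  have hκ0 : 0 ≤ κ := le_trans (abs_nonneg _) (hhκ 0 (Classical.arbitrary _))
  refine hs_block_cutMulY_GsqY_KhY_le_of_plain i hG hU D h s t (by positivity) (fun Ψ hΨ => ?_) hΛ
  exact hs_block_KhY_GsqY_cutMulY_le_distT i hG hC0 hC1 hreg D hh1 hhκ hhκ₂ hhb t s hΨ hn

end Transposed

/-! ## §3 The per-pair sixth member `∇_μ∇_νM_hG′_□M_h`, block to block -/

section Pair

variable [Nonempty (Fin N)] {c α₀ : ℝ}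

/-- ★ **THE PER-PAIR SIXTH MEMBER OF (3.46) FOR THE SANDWICHED LOCAL CUBE INVERSE, BLOCK `t` TO BLOCK `s`**: under file 28's hypotheses, for each pair `(μ, ν)`, blocks
`s t` and `Φ` on `Δ(t)`, `Σ_{z∈Δ(s)}HS((∇_μ∇_νM_hG′_□M_hΦ)(z)) ≤ C₃∕(e^{δ₀((d(t,s)−m)∕(2L)−1)})²·‖Φ‖²` (one term of file 32's `hessian_block_le`; the input of a flipped
`l2line3`). [cite: Balaban1985BackgroundPropagators, (3.46) p.398 (sixth member), Cor 3.6 p.408, (3.88)–(3.90) pp.409–410; Balaban1984PropagatorsII, (2.46) p.231; Agmon1982, Ch.1, Thm 1.5] -/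
theorem hessian_block_pair_le (hG : G ≤ B7Prop2Explicit.unitaryUnits (Matrix (Fin N) (Fin N) ℂ)) {U : CfgY (Matrix (Fin N) (Fin N) ℂ) i}
    (hC0 : 0 ≤ c * (kGeo i).M * α₀) (hC1 : c * (kGeo i).M * α₀ * ((d : ℝ) + 1) ≤ 1 / 16) (hreg : (bg9K (Matrix (Fin N) (Fin N) ℂ) G i).Reg335 c α₀ U)
    (D : Finset (SiteY i)) {h : SiteY i → ℝ} {κ κ₂ κb : ℝ} (hh1 : ∀ z, |h z| ≤ 1) (hhκ : ∀ μ z, |h (shiftY i μ z) - h z| ≤ κ)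
    (hhκ₂ : ∀ μ z, |h (shiftY i μ z) + h ((shiftY i μ).symm z) - 2 * h z| ≤ κ₂)
    (hhb : ∀ z w : SiteY i, blkOf i.D.toDomains w = blkOf i.D.toDomains z → |h z - h w| ≤ κb) (hhD : ∀ z, z ∉ D → h z = 0)
    {jD jD' : ℕ} (hjD : ∀ z ∈ D, (blkOf i.D.toDomains z).1.1 ≤ jD) (hjD' : ∀ z ∈ D, jD' ≤ (blkOf i.D.toDomains z).1.1)
    {ε : SiteY i → ℝ} {εD : ℝ} (hε0 : ∀ z, 0 ≤ ε z) (hεD0 : 0 ≤ εD)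
    (hF : ∀ μ ν z, ‖((plaqU (shiftY i) (UboxY i U) μ ν z : (Matrix (Fin N) (Fin N) ℂ)ˣ) : Matrix (Fin N) (Fin N) ℂ) - 1‖ ≤ ε z)
    (hεD : ∀ x μ ν, shiftY i ν (shiftY i μ x) ∈ D → ε x ≤ εD) (hεD' : ∀ x μ, shiftY i μ x ∈ D → ε x ≤ εD)
    (μ ν : Fin (d + 1)) (s t : BlkY i) {Φ : SiteY i → Matrix (Fin N) (Fin N) ℂ} (hΦ : ∀ z, blkOf i.D.toDomains z ≠ t → Φ z = 0) :
    ∑ z ∈ Finset.univ.filter (fun z : SiteY i => blkOf i.D.toDomains z = s), ∑ a, ∑ b,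
        ‖cdS i U μ (cdS i U ν (cutMulY h (GsqY i (parSymY i) D U (cutMulY h Φ)))) z a b‖ ^ 2
      ≤ (4 / 3 * (4 + 4 * (2560 * ((d : ℝ) + 1) * κ ^ 2 * ((((ℓ + 1) ^ jD : ℕ) : ℝ)) ^ 2
              + 1024 * (((d : ℝ) + 1) * κ₂) ^ 2 * (((((ℓ + 1) ^ jD : ℕ) : ℝ)) ^ 2) ^ 2
              + 512 * κb ^ 2 * ((((((ℓ + 1) ^ jD' : ℕ) : ℝ)) ^ 2)⁻¹) ^ 2 * (((((ℓ + 1) ^ jD : ℕ) : ℝ)) ^ 2) ^ 2)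
            + 512 * ((((((ℓ + 1) ^ jD' : ℕ) : ℝ)) ^ 2)⁻¹) ^ 2 * (((((ℓ + 1) ^ jD : ℕ) : ℝ)) ^ 2) ^ 2
            + 1024 * ((d : ℝ) + 1) ^ 2 * εD ^ 2 * (((((ℓ + 1) ^ jD : ℕ) : ℝ)) ^ 2) ^ 2
            + 2 * ((d : ℝ) + 1) * εD * (320 * ((((ℓ + 1) ^ jD : ℕ) : ℝ)) ^ 2 + 512 * ((d : ℝ) + 1) * κ ^ 2 * (((((ℓ + 1) ^ jD : ℕ) : ℝ)) ^ 2) ^ 2))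
          + 4 / 3 * (4 * (8 * ((d : ℝ) + 1) * κ ^ 2 * (2 * (160 * ((((ℓ + 1) ^ jD : ℕ) : ℝ)) ^ 2)) + 4 * (((d : ℝ) + 1) * κ₂) ^ 2 * (256 * (((((ℓ + 1) ^ jD : ℕ) : ℝ)) ^ 2 * ((((ℓ + 1) ^ jD : ℕ) : ℝ)) ^ 2)) + 2 * κb ^ 2 * ((((((ℓ + 1) ^ jD' : ℕ) : ℝ)) ^ 2)⁻¹ ^ 2 * (256 * (((((ℓ + 1) ^ jD : ℕ) : ℝ)) ^ 2 * ((((ℓ + 1) ^ jD : ℕ) : ℝ)) ^ 2))))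
        + 4 * (8 * ((d : ℝ) + 1) * (2 * (((ℓ + 1 : ℕ) : ℝ)) ^ 2 * ((((ℓ + 1) ^ jD' : ℕ) : ℝ))⁻¹) ^ 2 * (2 * (2 * (160 * ((((ℓ + 1) ^ jD : ℕ) : ℝ)) ^ 2) + 2 * ((d : ℝ) + 1) * κ ^ 2 * (256 * (((((ℓ + 1) ^ jD : ℕ) : ℝ)) ^ 2 * ((((ℓ + 1) ^ jD : ℕ) : ℝ)) ^ 2)))) + 4 * (((d : ℝ) + 1) * (2 * (((ℓ + 1 : ℕ) : ℝ)) ^ 4 * (((((ℓ + 1) ^ jD' : ℕ) : ℝ)) ^ 2)⁻¹)) ^ 2 * (256 * (((((ℓ + 1) ^ jD : ℕ) : ℝ)) ^ 2 * ((((ℓ + 1) ^ jD : ℕ) : ℝ)) ^ 2)) + 2 * (1 : ℝ) ^ 2 * ((((((ℓ + 1) ^ jD' : ℕ) : ℝ)) ^ 2)⁻¹ ^ 2 * (256 * (((((ℓ + 1) ^ jD : ℕ) : ℝ)) ^ 2 * ((((ℓ + 1) ^ jD : ℕ) : ℝ)) ^ 2))))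
        + 2 * ((((((ℓ + 1) ^ jD' : ℕ) : ℝ)) ^ 2)⁻¹ ^ 2 * (256 * (((((ℓ + 1) ^ jD : ℕ) : ℝ)) ^ 2 * ((((ℓ + 1) ^ jD : ℕ) : ℝ)) ^ 2)))
        + (((d : ℝ) + 1) ^ 2 * (4 * (εD ^ 2 * (256 * (((((ℓ + 1) ^ jD : ℕ) : ℝ)) ^ 2 * ((((ℓ + 1) ^ jD : ℕ) : ℝ)) ^ 2))))
          + 2 * ((d : ℝ) + 1) * εD * (2 * (2 * (160 * ((((ℓ + 1) ^ jD : ℕ) : ℝ)) ^ 2) + 2 * ((d : ℝ) + 1) * κ ^ 2 * (256 * (((((ℓ + 1) ^ jD : ℕ) : ℝ)) ^ 2 * ((((ℓ + 1) ^ jD : ℕ) : ℝ)) ^ 2))) + 2 * ((d : ℝ) + 1) * (2 * (((ℓ + 1 : ℕ) : ℝ)) ^ 2 * ((((ℓ + 1) ^ jD' : ℕ) : ℝ))⁻¹) ^ 2 * (256 * (((((ℓ + 1) ^ jD : ℕ) : ℝ)) ^ 2 * ((((ℓ + 1) ^ jD : ℕ) : ℝ)) ^ 2))))))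
          / Real.exp ((1 / (4 * ((d : ℝ) + 2))) * (((((bondT i.D).dist t s : ℕ) : ℝ) - (((((d + 1) * (4 * (ℓ + 1) + 1)) + 3 : ℕ)) : ℝ)) / (2 * ((ℓ + 1 : ℕ) : ℝ)) - 1)) ^ 2
        * trIP (fun _ => (1 : ℝ)) Φ Φ := by
  refine le_trans (Finset.sum_le_sum fun z _ => ?_) (hessian_block_le i hG hC0 hC1 hreg D hh1 hhκ hhκ₂ hhb hhD hjD hjD' hε0 hεD0 hF hεD hεD' s t hΦ)
  have hnn : ∀ (μ' ν' : Fin (d + 1)), 0 ≤ ∑ a, ∑ b, ‖cdS i U μ' (cdS i U ν' (cutMulY h (GsqY i (parSymY i) D U (cutMulY h Φ)))) z a b‖ ^ 2 := fun _ _ => hs_nonneg _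
  calc ∑ a, ∑ b, ‖cdS i U μ (cdS i U ν (cutMulY h (GsqY i (parSymY i) D U (cutMulY h Φ)))) z a b‖ ^ 2
      ≤ ∑ ν' : Fin (d + 1), ∑ a, ∑ b, ‖cdS i U μ (cdS i U ν' (cutMulY h (GsqY i (parSymY i) D U (cutMulY h Φ)))) z a b‖ ^ 2 :=
        Finset.single_le_sum (f := fun ν' => ∑ a, ∑ b, ‖cdS i U μ (cdS i U ν' (cutMulY h (GsqY i (parSymY i) D U (cutMulY h Φ)))) z a b‖ ^ 2)
          (fun ν' _ => hnn μ ν') (Finset.mem_univ ν)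
    _ ≤ ∑ μ' : Fin (d + 1), ∑ ν' : Fin (d + 1), ∑ a, ∑ b, ‖cdS i U μ' (cdS i U ν' (cutMulY h (GsqY i (parSymY i) D U (cutMulY h Φ)))) z a b‖ ^ 2 :=
        Finset.single_le_sum (f := fun μ' => ∑ ν' : Fin (d + 1), ∑ a, ∑ b, ‖cdS i U μ' (cdS i U ν' (cutMulY h (GsqY i (parSymY i) D U (cutMulY h Φ)))) z a b‖ ^ 2)
          (fun μ' _ => Finset.sum_nonneg fun ν' _ => hnn μ' ν') (Finset.mem_univ μ)

end Pair

end Literature.MathematicalPhysics.QuantumFieldTheory.Balaban1983to89.B9Thm31SiteGsqTransposedFactorsReg335Y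

end
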